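import Literature.AlgebraicGeometry.Resolution.CompletedPullbackRegular
import Literature.AlgebraicGeometry.Resolution.FormalFibresRegularDerivations
import Literature.AlgebraicGeometry.Resolution.AdicNoetherian
import Mathlib.AlgebraicGeometry.Morphisms.Proper
import Mathlib.AlgebraicGeometry.Morphisms.Finite
import Mathlib.RingTheory.Localization.Integral
import Mathlib.RingTheory.Localization.BaseChange
import Mathlib.RingTheory.Localization.LocalizationLocalization
import Mathlib.RingTheory.IntegralClosure.IsIntegral.Basic
import Mathlib.RingTheory.TensorProduct.Maps
import Mathlib.LinearAlgebra.FiniteDimensional.Defs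
import Mathlib.LinearAlgebra.Basis.SMul
import HarnessLib

/-!
# Proper regular models force quasi-excellence of the base ring (EGA IV₂ 7.9.5, ring form)

Topic: `Literature/AlgebraicGeometry/Resolution`. The ring-theoretic form of Grothendieck's theorem
"resolution of singularities forces quasi-excellence" (EGA IV₂ (7.9.5); Temkin 2008, §1;
named fact `Grothendieck1965_7_9_5` of
`Literature/Barriers/ResolutionOfSingularities/QuasiExcellenceNecessary.lean`), PROVED:

* `HasProperRegularModels C` — every integral affine scheme `Spec A` of finite type over `C`
  receives a proper morphism `π : Y → Spec A` from a regular scheme `Y` which is an isomorphism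
  over a non-empty principal open `D(g)` (precisely: an open immersion `Spec A_g → Y` over
  `Spec A`). This is what a resolution of singularities of `Spec A` provides (a proper
  birational morphism from a regular scheme; for Temkin's blow-ups see the Barriers proof file).
* `isRegularRing_tensor_completion_of_model` — for `D` Noetherian, `P` prime, `Ŝ = (D_P)^`,
  `D'` finite over `D` and a proper regular model `Y → Spec D'` trivial over `D(g)`:
  `D'_g ⊗_D Ŝ` is a regular ring (it is the ring of an affine open of the regular scheme
  `Y ×_{Spec D} Spec Ŝ`, `isRegular_pullback_of_closedFibre`, `CompletedPullbackRegular.lean`).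
* `hasGeomRegularGenericFormalFibre_of_hasProperRegularModels` — for a Noetherian domain `D`
  with `HasProperRegularModels D`, the generic formal fibre of every `D_P` is geometrically
  regular: for `L/K` finite (`K = Frac D`), `L ⊗_{D_P} (D_P)^ = L ⊗_D Ŝ` is a localisation of
  `D'_g ⊗_D Ŝ` for a finite `D`-subalgebra `D' ⊆ L` with `Frac D' = L`
  (`exists_finite_subalgebra_isFractionRing`, `FormalFibresRegularDerivations.lean`).
* `isGRing_of_hasProperRegularModels` — a Noetherian ring with `HasProperRegularModels` is a
  G-ring (reduction to the generic formal fibres of the quotient domains, Stacks 07PN,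
  `isGeometricallyRegular_formalFibre_of_quotient`, `FormalFibres.lean`).
* `isJ2Ring_of_hasProperRegularModels` — it is J-2 (`D(g) ⊆ Reg(B/𝔭)` is a non-empty open;
  Nagata's criterion, Matsumura Thm. 24.4, `NagataCriterion.lean`).
* `isQuasiExcellentRing_of_hasProperRegularModels` — hence quasi-excellent.

## Sources

* A. Grothendieck, EGA IV₂ (Publ. Math. IHÉS 24, 1965), (7.9.5) and §7.9. [EGAIV2]
* M. Temkin, *Desingularization of quasi-excellent schemes in characteristic zero*, Adv. Math.
  219 (2008), §1 (statement attributed to Grothendieck). [Temkin2008]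
* The Stacks Project, Tag 07PN. [StacksProject]
-/

noncomputable section

open CategoryTheory CategoryTheory.Limits AlgebraicGeometry TopologicalSpace TensorProduct
  IsLocalRing

open scoped nonZeroDivisors

namespace Literature.AlgebraicGeometry.Resolution

universe u

/-! ## Proper regular models -/

/-- **Every integral finite type `C`-algebra has a proper regular model, trivial over a dense
open**: for every domain `A` of finite type over `C` there are a regular scheme `Y`, a proper
morphism `π : Y → Spec A`, a non-zero `g ∈ A` and an open immersion `j : Spec A_g → Y` with
`j ≫ π = (Spec A_g → Spec A)`, i.e. `π` has an open-immersion section over the principal open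
`D(g)`. Every resolution of singularities of `Spec A` which is an isomorphism over `D(g)` is such
a model (e.g. a blow-up with regular source whose centre misses the generic point; cf. EGA IV₂
§7.9, Temkin 2008 §1). An auxiliary notion of this file. [folklore] -/
def HasProperRegularModels (C : Type u) [CommRing C] : Prop :=
  ∀ (A : Type u) [CommRing A] [IsDomain A] [Algebra C A], Algebra.FiniteType C A →
    ∃ (Y : Scheme.{u}) (π : Y ⟶ Spec (.of A)) (g : A), g ≠ 0 ∧ IsProper π ∧
      Scheme.IsRegular Y ∧ ∃ j : Spec (.of (Localization.Away g)) ⟶ Y, IsOpenImmersion j ∧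
        j ≫ π = Spec.map (CommRingCat.ofHom (algebraMap A (Localization.Away g)))

/-- `HasProperRegularModels` passes to finite type algebras (finite type over finite type is
finite type). [folklore] -/
theorem HasProperRegularModels.of_finiteType {C : Type u} [CommRing C]
    (h : HasProperRegularModels C) (C' : Type u) [CommRing C'] [Algebra C C']
    [Algebra.FiniteType C C'] : HasProperRegularModels C' := by
  intro A _ _ _ hA
  letI : Algebra C A := ((algebraMap C' A).comp (algebraMap C C')).toAlgebra
  haveI : IsScalarTower C C' A := IsScalarTower.of_algebraMap_eq fun _ => rfl
  haveI : Algebra.FiniteType C A := Algebra.FiniteType.trans (S := C') inferInstance hA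
  exact h A inferInstance

/-! ## Localisations and affine opens of regular schemes -/

/-- If `A ⊗_D E` is a regular ring and `L = Frac A`, then `L ⊗_D E = L ⊗_A (A ⊗_D E)` is a
regular ring (a localisation of `A ⊗_D E`). The fraction field hypothesis is an explicit
argument (not an instance) on purpose. [folklore] -/
theorem isRegularRing_tensor_of_isFractionRing {D : Type u} [CommRing D] (E : Type u)
    [CommRing E] [Algebra D E] (A L : Type u) [CommRing A] [Algebra D A] [Field L] [Algebra A L]
    [Algebra D L] [IsScalarTower D A L] (hAL : IsFractionRing A L) [IsRegularRing (A ⊗[D] E)] :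
    IsRegularRing (L ⊗[D] E) := by
  letI : Algebra (A ⊗[D] E) (L ⊗[A] (A ⊗[D] E)) := Algebra.TensorProduct.rightAlgebra
  haveI : IsLocalization (Algebra.algebraMapSubmonoid (A ⊗[D] E) A⁰) (L ⊗[A] (A ⊗[D] E)) :=
    IsLocalization.tensorRight (R := A) (S := A ⊗[D] E) L A⁰
  haveI : IsRegularRing (L ⊗[A] (A ⊗[D] E)) :=
    isRegularRing_of_isLocalization (A := A ⊗[D] E) (Algebra.algebraMapSubmonoid (A ⊗[D] E) A⁰)
      (L ⊗[A] (A ⊗[D] E))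
  exact IsRegularRing.of_ringEquiv (R := L ⊗[A] (A ⊗[D] E))
    (Algebra.TensorProduct.cancelBaseChange D A L L E).toRingEquiv

/-- The spectrum of a Noetherian ring all of whose points have regular local rings is the
spectrum of a regular ring (used through an open immersion into a regular scheme). [folklore] -/
theorem isRegularRing_of_isOpenImmersion_of_isRegular {T : Type u} [CommRing T]
    [IsNoetherianRing T] {Z : Scheme.{u}} (c : Spec (.of T) ⟶ Z) [IsOpenImmersion c]
    (hZ : Scheme.IsRegular Z) : IsRegularRing T :=
  isRegularRing_iff.mpr fun q _ =>
    (isRegularLocalRing_stalk_Spec_iff T ⟨q, ‹_›⟩).mp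
      ((isRegularLocalRing_stalk_iff_of_isOpenImmersion c ⟨q, ‹_›⟩).mp (hZ _))

/-! ## The completion `(D_P)^` as a `D`-algebra -/

section Completion

variable (D : Type u) [CommRing D] [IsNoetherianRing D] (P : Ideal D) [P.IsPrime]

omit [IsNoetherianRing D] in
/-- `IsScalarTower D D_P (D_P)^` (with `CompletionAtPrime D P = (D_P)^` of
`FormalFibresRegularDerivations.lean`). [folklore] -/
theorem isScalarTower_completionAtPrime :
    IsScalarTower D (Localization.AtPrime P) (CompletionAtPrime D P) :=
  IsScalarTower.of_algebraMap_eq fun d => by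
    rw [AdicCompletion.algebraMap_apply, AdicCompletion.algebraMap_apply, Algebra.algebraMap_self,
      RingHom.id_apply]

/-- `(D_P)^` is Noetherian (Stacks 0316). [folklore] -/
theorem isNoetherianRing_completionAtPrime : IsNoetherianRing (CompletionAtPrime D P) :=
  isNoetherianRing_adicCompletion_maximalIdeal _

/-- `(D_P)^` is flat over `D` (`D → D_P` and `D_P → (D_P)^` are flat). [folklore] -/
theorem flat_completionAtPrime : Module.Flat D (CompletionAtPrime D P) :=
  haveI := isScalarTower_completionAtPrime D P
  Module.Flat.trans D (Localization.AtPrime P) (CompletionAtPrime D P)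

/-- `𝔪_Ŝ = P Ŝ` for `Ŝ = (D_P)^`. [folklore] -/
theorem maximalIdeal_completionAtPrime :
    maximalIdeal (CompletionAtPrime D P) = P.map (algebraMap D (CompletionAtPrime D P)) := by
  haveI := isScalarTower_completionAtPrime D P
  rw [AdicCompletion.maximalIdeal_eq_map]
  have h1 : (P.map (algebraMap D (Localization.AtPrime P))).map
      (algebraMap (Localization.AtPrime P) (CompletionAtPrime D P)) =
      P.map (algebraMap D (CompletionAtPrime D P)) := by
    rw [Ideal.map_map, ← IsScalarTower.algebraMap_eq]
  rw [← h1, Localization.AtPrime.map_eq_maximalIdeal]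

/-- `𝔪_Ŝ ∩ D ⊆ P` (in fact `= P`) for `Ŝ = (D_P)^`. [folklore] -/
theorem comap_maximalIdeal_completionAtPrime_le :
    (maximalIdeal (CompletionAtPrime D P)).comap (algebraMap D (CompletionAtPrime D P)) ≤ P := by
  haveI := isScalarTower_completionAtPrime D P
  intro x hx
  by_contra hxP
  have hu : IsUnit (algebraMap D (Localization.AtPrime P) x) :=
    IsLocalization.map_units _ (⟨x, hxP⟩ : P.primeCompl)
  have hu' : IsUnit (algebraMap D (CompletionAtPrime D P) x) := by
    rw [IsScalarTower.algebraMap_apply D (Localization.AtPrime P) (CompletionAtPrime D P)]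
    exact hu.map _
  exact (mem_maximalIdeal _).mp (Ideal.mem_comap.mp hx) hu'

/-- The residue field of `Ŝ = (D_P)^` is generated by `D_P`: every `e ∈ Ŝ` has
`u e ≡ d (mod 𝔪_Ŝ)` for some `d ∈ D`, `u ∈ D ∖ P` (`Ŝ/𝔪_Ŝ = D_P/P D_P`). [folklore] -/
theorem exists_mul_sub_mem_maximalIdeal_completionAtPrime (e : CompletionAtPrime D P) :
    ∃ d : D, ∃ u ∉ P, algebraMap D (CompletionAtPrime D P) u * e -
      algebraMap D (CompletionAtPrime D P) d ∈ maximalIdeal (CompletionAtPrime D P) := by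
  haveI := isScalarTower_completionAtPrime D P
  set S := Localization.AtPrime P
  obtain ⟨sbar, hsbar⟩ := (AdicCompletion.residueField_map_bijective (R := S)).2
    (IsLocalRing.residue (CompletionAtPrime D P) e)
  obtain ⟨s, rfl⟩ := IsLocalRing.residue_surjective sbar
  rw [IsLocalRing.ResidueField.map_residue] at hsbar
  replace hsbar := Ideal.Quotient.eq.mp hsbar
  obtain ⟨⟨d, u⟩, hdu⟩ := IsLocalization.surj P.primeCompl s
  refine ⟨d, u, u.2, ?_⟩
  have h1 : algebraMap D (CompletionAtPrime D P) u * e - algebraMap D (CompletionAtPrime D P) d =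
      algebraMap S (CompletionAtPrime D P) (algebraMap D S u) *
        (e - algebraMap S (CompletionAtPrime D P) s) := by
    rw [mul_sub, ← map_mul, mul_comm (algebraMap D S u) s, hdu,
      ← IsScalarTower.algebraMap_apply, ← IsScalarTower.algebraMap_apply]
  rw [h1]
  refine Ideal.mul_mem_left _ _ ?_
  have := neg_mem hsbar
  rwa [neg_sub] at this

end Completion

/-! ## The model base-changed to the completion -/

section Model

variable {D : Type u} [CommRing D] [IsNoetherianRing D] (P : Ideal D) [P.IsPrime]
  {D' : Type u} [CommRing D'] [Algebra D D'] [Module.Finite D D']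
  {Y : Scheme.{u}} (π : Y ⟶ Spec (.of D')) [IsProper π] (hY : Scheme.IsRegular Y)
  (g : D') (j : Spec (.of (Localization.Away g)) ⟶ Y) [IsOpenImmersion j]
  (hj : j ≫ π = Spec.map (CommRingCat.ofHom (algebraMap D' (Localization.Away g))))

include hY hj in
/-- **`D'_g ⊗_D Ŝ` is a regular ring** for a proper regular model `π : Y → Spec D'` trivial over
`D(g)`, `D'` finite over the Noetherian ring `D`, `Ŝ = (D_P)^`: `Spec (D'_g ⊗_D Ŝ)` is an
affine open of `Y ×_{Spec D} Spec Ŝ`, which is regular (`isRegular_pullback_of_closedFibre`).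
[cite: EGAIV2, (7.9.5) proof] -/
theorem isRegularRing_tensor_completion_of_model :
    IsRegularRing (Localization.Away g ⊗[D] CompletionAtPrime D P) := by
  haveI := isNoetherianRing_completionAtPrime D P
  haveI := flat_completionAtPrime D P
  set q : Y ⟶ Spec (.of D) := π ≫ Spec.map (CommRingCat.ofHom (algebraMap D D')) with hq
  haveI : IsFinite (Spec.map (CommRingCat.ofHom (algebraMap D D'))) := by
    rw [IsFinite.SpecMap_iff]
    exact RingHom.finite_algebraMap.mpr inferInstance
  haveI : UniversallyClosed q := by rw [hq]; infer_instance
  haveI : LocallyOfFiniteType q := by rw [hq]; infer_instance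
  have hZ : Scheme.IsRegular (pullback q (specOfAlgebra D (CompletionAtPrime D P))) :=
    isRegular_pullback_of_closedFibre (CompletionAtPrime D P) P
      (exists_mul_sub_mem_maximalIdeal_completionAtPrime D P)
      (maximalIdeal_completionAtPrime D P) (comap_maximalIdeal_completionAtPrime_le D P) q hY
  have hj' : j ≫ q = Spec.map (CommRingCat.ofHom (algebraMap D (Localization.Away g))) := by
    rw [hq, reassoc_of% hj, ← Spec.map_comp, ← CommRingCat.ofHom_comp,
      ← IsScalarTower.algebraMap_eq]
  haveI : Algebra.FiniteType D (Localization.Away g) :=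
    Algebra.FiniteType.trans (S := D') inferInstance (IsLocalization.finiteType_of_monoid_fg
      (Submonoid.powers g) _)
  haveI : IsNoetherianRing (Localization.Away g ⊗[D] CompletionAtPrime D P) :=
    isNoetherianRing_tensor_of_finiteType (CompletionAtPrime D P) _
  exact isRegularRing_of_isOpenImmersion_of_isRegular
    (specTensorChart (CompletionAtPrime D P) q j hj') hZ

end Model

/-! ## Geometrically regular generic formal fibres -/

section GenericFibre

variable {D : Type u} [CommRing D] [IsDomain D] [IsNoetherianRing D] (P : Ideal D) [P.IsPrime]

/-- **`L ⊗_D Ŝ` is regular** for `L` a finite extension of `Frac D`, given proper regular models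
over `D`: with `D' ⊆ L` finite over `D`, `Frac D' = L`
(`exists_finite_subalgebra_isFractionRing`), and a model `Y → Spec D'` trivial over `D(g)`,
`L ⊗_D Ŝ = L ⊗_{D'_g} (D'_g ⊗_D Ŝ)` is a localisation of the regular ring `D'_g ⊗_D Ŝ`
(`isRegularRing_tensor_completion_of_model`). [cite: EGAIV2, (7.9.5)] -/
theorem isRegularRing_tensor_completion_of_hasProperRegularModels (h : HasProperRegularModels D)
    (K L : Type u) [Field K] [Field L] [Algebra D K] [IsFractionRing D K] [Algebra K L]
    [Algebra D L] [IsScalarTower D K L] [Module.Finite K L] :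
    IsRegularRing (L ⊗[D] CompletionAtPrime D P) := by
  obtain ⟨D', hD'fin, hD'frac, -⟩ := exists_finite_subalgebra_isFractionRing D K L (0 : L)
  haveI := hD'fin
  haveI := hD'frac
  obtain ⟨Y, π, g, hg0, hπ, hY, j, hj, hjπ⟩ := h D' inferInstance
  haveI := hπ
  haveI := hj
  set A := Localization.Away g with hA
  -- `L` is the fraction field of `D'_g`
  letI : Algebra A L := (IsLocalization.Away.lift g (g := algebraMap D' L)
    (isUnit_iff_ne_zero.mpr ((map_ne_zero_iff _ Subtype.val_injective).mpr hg0))).toAlgebra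
  haveI : IsScalarTower D' A L := IsScalarTower.of_algebraMap_eq fun x =>
    (IsLocalization.Away.lift_eq g _ x).symm
  have hAL : IsFractionRing A L := IsFractionRing.isFractionRing_of_isDomain_of_isLocalization
    (Submonoid.powers g) A L
  haveI : IsScalarTower D A L := IsScalarTower.of_algebraMap_eq fun x => by
    rw [IsScalarTower.algebraMap_apply D D' A, ← IsScalarTower.algebraMap_apply D' A L,
      ← IsScalarTower.algebraMap_apply D D' L]
  -- the regular ring `A ⊗_D Ŝ` and its localisation `L ⊗_A (A ⊗_D Ŝ) = L ⊗_D Ŝ`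
  haveI hreg : IsRegularRing (A ⊗[D] CompletionAtPrime D P) :=
    isRegularRing_tensor_completion_of_model P π hY g j hjπ
  exact isRegularRing_tensor_of_isFractionRing (CompletionAtPrime D P) A L hAL

/-- **Proper regular models force geometrically regular generic formal fibres** (EGA IV₂
(7.9.5), G-ring half, generic fibre): let `D` be a Noetherian domain such that every integral
finite type `D`-algebra has a proper regular model trivial over a dense open. Then for every
prime `P` the generic formal fibre `K ⊗_{D_P} (D_P)^` (`K = Frac D = κ((0))`) is geometrically
regular over `K`: the only prime of `D_P` over `(0)` is `(0)`
(`eq_bot_of_comap_eq_bot_localizationAtPrime`), and for `L/K` finite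
`L ⊗_K (K ⊗_{D_P} Ŝ) ≅ L ⊗_{D_P} Ŝ ≅ L ⊗_D Ŝ` (`D_P` is a localisation of `D`, Mathlib's
`IsLocalization.algebraTensorEquiv`) is regular by
`isRegularRing_tensor_completion_of_hasProperRegularModels`.
[cite: EGAIV2, (7.9.5)] [cite: Temkin2008, §1] -/
theorem hasGeomRegularGenericFormalFibre_of_hasProperRegularModels
    (h : HasProperRegularModels D) : HasGeomRegularGenericFormalFibre D P := by
  intro p' _ hp' L _ _ hfin
  haveI := hfin
  obtain rfl := eq_bot_of_comap_eq_bot_localizationAtPrime D P p' hp'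
  haveI : IsFractionRing D (⊥ : Ideal (Localization.AtPrime P)).ResidueField :=
    isFractionRing_residueField_bot D P
  letI : Algebra (Localization.AtPrime P) L :=
    ((algebraMap (⊥ : Ideal (Localization.AtPrime P)).ResidueField L).comp
      (algebraMap (Localization.AtPrime P) _)).toAlgebra
  haveI : IsScalarTower (Localization.AtPrime P)
      (⊥ : Ideal (Localization.AtPrime P)).ResidueField L :=
    IsScalarTower.of_algebraMap_eq fun _ => rfl
  letI : Algebra D L :=
    ((algebraMap (Localization.AtPrime P) L).comp (algebraMap D (Localization.AtPrime P))).toAlgebra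
  haveI : IsScalarTower D (Localization.AtPrime P) L := IsScalarTower.of_algebraMap_eq fun _ => rfl
  haveI : IsScalarTower D (⊥ : Ideal (Localization.AtPrime P)).ResidueField L :=
    IsScalarTower.of_algebraMap_eq fun r => by
      change _ = algebraMap _ L (algebraMap D (⊥ : Ideal (Localization.AtPrime P)).ResidueField r)
      rw [IsScalarTower.algebraMap_apply D (Localization.AtPrime P)
        (⊥ : Ideal (Localization.AtPrime P)).ResidueField r]
      rfl
  haveI : IsRegularRing (L ⊗[D] CompletionAtPrime D P) :=
    isRegularRing_tensor_completion_of_hasProperRegularModels P h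
      (⊥ : Ideal (Localization.AtPrime P)).ResidueField L
  -- `L ⊗_κ (κ ⊗_S Ŝ) ≅ L ⊗_S Ŝ ≅ L ⊗_D Ŝ`
  have e₁ := Algebra.TensorProduct.cancelBaseChange (Localization.AtPrime P)
    (⊥ : Ideal (Localization.AtPrime P)).ResidueField L L (CompletionAtPrime D P)
  have e₂ := IsLocalization.algebraTensorEquiv P.primeCompl (Localization.AtPrime P) L
    (CompletionAtPrime D P)
  exact IsRegularRing.of_ringEquiv (e₁.toRingEquiv.trans e₂.toRingEquiv).symm

end GenericFibre

/-! ## The G-ring property -/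

/-- **A Noetherian ring all of whose integral finite type algebras have proper regular models
is a G-ring** (EGA IV₂ (7.9.5), G-ring half): `A_P → (A_P)^` is flat (Mathlib), and the formal
fibre over `𝔭'` is the generic formal fibre of `(A/𝔮)_{P/𝔮}`, `𝔮 = 𝔭' ∩ A` (Stacks 07PN,
`isGeometricallyRegular_formalFibre_of_quotient`), which is geometrically regular by
`hasGeomRegularGenericFormalFibre_of_hasProperRegularModels` applied to the domain `A/𝔮`.
[cite: EGAIV2, (7.9.5)] [cite: Temkin2008, §1] -/
theorem isGRing_of_hasProperRegularModels (C : Type u) [CommRing C] [IsNoetherianRing C]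
    (h : HasProperRegularModels C) : IsGRing C := by
  refine ⟨inferInstance, fun P _ => ⟨AdicCompletion.flat_of_isNoetherian _, fun p' _ => ?_⟩⟩
  let q : Ideal C := p'.comap (algebraMap C (Localization.AtPrime P))
  have hqP : q ≤ P := fun a ha =>
    (IsLocalization.AtPrime.to_map_mem_maximal_iff (Localization.AtPrime P) P a).mp
      (IsLocalRing.le_maximalIdeal (Ideal.IsPrime.ne_top ‹p'.IsPrime›) ha)
  haveI : q.IsPrime := Ideal.comap_isPrime _ p'
  have hker : RingHom.ker (Ideal.Quotient.mk q) ≤ P := by rwa [Ideal.mk_ker]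
  haveI hPbar : (P.map (Ideal.Quotient.mk q)).IsPrime :=
    Ideal.map_isPrime_of_surjective Ideal.Quotient.mk_surjective hker
  have hP : P = (P.map (Ideal.Quotient.mk q)).comap (Ideal.Quotient.mk q) := by
    rw [Ideal.comap_map_of_surjective _ Ideal.Quotient.mk_surjective, ← RingHom.ker_eq_comap_bot,
      Ideal.mk_ker, sup_eq_left.mpr hqP]
  refine isGeometricallyRegular_formalFibre_of_quotient P p' q rfl (P.map (Ideal.Quotient.mk q))
    hP ?_
  haveI : Algebra.FiniteType C (C ⧸ q) := inferInstance
  exact hasGeomRegularGenericFormalFibre_of_hasProperRegularModels _ (h.of_finiteType (C ⧸ q))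

/-! ## The J-2 property -/

/-- **A Noetherian ring all of whose integral finite type algebras have proper regular models is
J-2** (EGA IV₂ (7.9.5), openness half): for `B` of finite type over `C` and a prime `𝔭`, a model
`Y → Spec (B/𝔭)` trivial over `D(g)`, `g ≠ 0`, shows that `(B/𝔭)_g` is a regular ring, so the
non-empty open `D(g) ⊆ Reg(B/𝔭)`; hence `Reg(B)` is open by Nagata's criterion (Matsumura,
Thm. 24.4, `Matsumura1987_24_4`). [cite: EGAIV2, (7.9.5)] [cite: Matsumura1987, Thm. 24.4] -/
theorem isJ2Ring_of_hasProperRegularModels (C : Type u) [CommRing C] [IsNoetherianRing C]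
    (h : HasProperRegularModels C) : IsJ2Ring C := by
  refine ⟨inferInstance, fun B _ _ hB => ?_⟩
  haveI := hB
  haveI : IsNoetherianRing B := Algebra.FiniteType.isNoetherianRing C B
  refine Matsumura1987_24_4 fun p _ => ?_
  haveI : Algebra.FiniteType C (B ⧸ p) := Algebra.FiniteType.trans (S := B) hB inferInstance
  obtain ⟨Y, π, g, hg0, hπ, hY, j, hj, hjπ⟩ := h (B ⧸ p) inferInstance
  haveI := hj
  set A := Localization.Away g
  haveI hA : IsRegularRing A := isRegularRing_of_isOpenImmersion_of_isRegular j hY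
  refine ⟨PrimeSpectrum.basicOpen g, (PrimeSpectrum.basicOpen g).2, ⟨⟨⊥, Ideal.isPrime_bot⟩, ?_⟩,
    fun q hq => ?_⟩
  · exact (PrimeSpectrum.mem_basicOpen g _).mpr (by simpa using hg0)
  · -- `(B/𝔭)_𝔮 = A_{𝔮 A}` is regular
    have hgq : g ∉ q.asIdeal := (PrimeSpectrum.mem_basicOpen g q).mp hq
    have hdisj : Disjoint (Submonoid.powers g : Set (B ⧸ p)) q.asIdeal := by
      rw [Set.disjoint_left]
      rintro _ ⟨n, rfl⟩ hn
      exact hgq (q.2.mem_of_pow_mem n hn)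
    let q' : Ideal A := q.asIdeal.map (algebraMap (B ⧸ p) A)
    haveI hq' : q'.IsPrime := IsLocalization.isPrime_of_isPrime_disjoint (Submonoid.powers g) A
      q.asIdeal q.2 hdisj
    have hcomap : q'.comap (algebraMap (B ⧸ p) A) = q.asIdeal :=
      IsLocalization.under_map_of_isPrime_disjoint (Submonoid.powers g) A q.2 hdisj
    haveI : IsScalarTower (B ⧸ p) A (Localization.AtPrime q') :=
      IsScalarTower.of_algebraMap_eq' rfl
    haveI : IsLocalization.AtPrime (Localization.AtPrime q') (q'.comap (algebraMap (B ⧸ p) A)) :=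
      IsLocalization.isLocalization_isLocalization_atPrime_isLocalization (Submonoid.powers g)
        (Localization.AtPrime q') q'
    have hqeq : (⟨q'.comap (algebraMap (B ⧸ p) A), Ideal.comap_isPrime _ q'⟩ :
        PrimeSpectrum (B ⧸ p)) = q := PrimeSpectrum.ext hcomap
    rw [← hqeq, mem_regularLocus]
    exact IsRegularLocalRing.of_ringEquiv (IsLocalization.algEquiv
      (q'.comap (algebraMap (B ⧸ p) A)).primeCompl (Localization.AtPrime q')
      (Localization.AtPrime (q'.comap (algebraMap (B ⧸ p) A)))).toRingEquiv

/-! ## Quasi-excellence -/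

/-- **A Noetherian ring all of whose integral finite type algebras have proper regular models
(resolutions of singularities trivial over a dense open) is quasi-excellent** — the ring form of
Grothendieck's EGA IV₂ (7.9.5) as rendered by Temkin (2008, §1): G-ring by
`isGRing_of_hasProperRegularModels`, J-2 by `isJ2Ring_of_hasProperRegularModels`.
[cite: EGAIV2, (7.9.5)] [cite: Temkin2008, §1 and Thm. 3.4.3] -/
theorem isQuasiExcellentRing_of_hasProperRegularModels (C : Type u) [CommRing C]
    [IsNoetherianRing C] (h : HasProperRegularModels C) : IsQuasiExcellentRing C :=
  ⟨isGRing_of_hasProperRegularModels C h, isJ2Ring_of_hasProperRegularModels C h⟩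

end Literature.AlgebraicGeometry.Resolution

end
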